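import Summits.SmoothPoincare4.SmoothPoincare4.Theorems.CongruenceShadowsShadowApproximationStubLayerStepZeroOneJohnson
import HarnessLib

/-!
# Helper `helper_johnsonDeepProduct` (the Johnson map of `𝒥ₖ` modulo `γ₂ₖ₊₁`; relation products) for stub
`stub_layerStepZeroThree` of line `nilpotent-genus-class`, crux `CongruenceShadows.ShadowApproximation`
(item stmt-SmoothPoincare4-14595)

General group theory (`γₙ₊₁ = (⊤ : Subgroup G).lowerCentralSeries n`, `𝒥ₖ = {ψ ∈ Aut G | ψ(s)s⁻¹ ∈ γₖ₊₁}`), one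
layer DEEPER than the sibling `…StubLayerStepZeroOneJohnson` (which computes `x ↦ ψ(x)x⁻¹` modulo `γₖ₊₂`):
for `k ≥ 1` the Johnson map `ψ ↦ (x ↦ ψ(x)x⁻¹ mod γ₂ₖ₊₁)` is still a HOMOMORPHISM on `𝒥ₖ`
(`jkd_quot_trans`: `φψ(x)x⁻¹ = φ(u)u⁻¹ · u · φ(x)x⁻¹` with `u = ψ(x)x⁻¹ ∈ γₖ₊₁`, `φ(u)u⁻¹ ∈ γ₂ₖ₊₁`, and
`γₖ₊₁` is abelian modulo `γ₂ₖ₊₁`), whence the value of a RELATION PRODUCT `y = ∏ Ψᵢ ^ nᵢ` (`Ψᵢ ∈ 𝒥ₖ`) is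
`y(x)x⁻¹ ≡ ∏ (Ψᵢ(x)x⁻¹) ^ nᵢ (mod γ₂ₖ₊₁)` (`jkd_list_prod_zpow`).  For the `(0,3)` layer step this is the device
by which the realisers of the index-`1` certificate (products of level-`3` Goeritz elements `rⱼ` with
`∑ nⱼ τ₃(rⱼ) = 0`, worker W-D) get their degree-`5` data from the (degree `4` and `5`) Magnus data of the SHORT
words `rⱼ` alone (modulo `γ₇`), see the evaluator design `work/stubs/zeroThree/DESIGN.md` of the line folder.
* `helper_johnsonDeepProduct` — the registered closed form for the surface groups.
No definitions, no notations.
-/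

set_option linter.dupNamespace false

noncomputable section

open Subgroup
open Summit.SmoothPoincare4.SmoothPoincare4.Theorems.NilpotentShadowsStandard.SaturatedTorsorDescent
open scoped commutatorElement

namespace Summit.SmoothPoincare4.SmoothPoincare4.Theorems.ShadowApproximation.NilpotentGenusClass

namespace LayerZeroThree

open LayerZeroOne

section General

variable {G : Type*} [Group G] {k : ℕ}

/-- `γₖ₊₁` is abelian modulo `γ₂ₖ₊₁`. [folklore] -/
theorem jkd_comm {u v : G} (hu : u ∈ (⊤ : Subgroup G).lowerCentralSeries k)
    (hv : v ∈ (⊤ : Subgroup G).lowerCentralSeries k) :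
    ((u * v : G) : G ⧸ (⊤ : Subgroup G).lowerCentralSeries (k + k)) = ((v * u : G) : G ⧸ _) := by
  rw [eq_comm, ← mul_inv_mem_iff_quot]
  have e : v * u * (u * v)⁻¹ = ⁅v, u⁆ := by simp only [commutatorElement_def]; group
  rw [e]
  exact lcs_antitone (Nat.le_succ _) (Literature.GroupTheory.CombinatorialGroupTheory.commutator_mem_lcs hv hu)

/-- **The deep Johnson map of a composite**: for `ψ, φ ∈ 𝒥ₖ`, `φ(ψ x) x⁻¹ ≡ (φx x⁻¹)(ψx x⁻¹) (mod γ₂ₖ₊₁)`.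
[folklore] -/
theorem jkd_quot_trans {ψ φ : G ≃* G} (hψ : ∀ s, ψ s * s⁻¹ ∈ (⊤ : Subgroup G).lowerCentralSeries k)
    (hφ : ∀ s, φ s * s⁻¹ ∈ (⊤ : Subgroup G).lowerCentralSeries k) (x : G) :
    ((φ (ψ x) * x⁻¹ : G) : G ⧸ (⊤ : Subgroup G).lowerCentralSeries (k + k)) =
      ((φ x * x⁻¹ : G) : G ⧸ (⊤ : Subgroup G).lowerCentralSeries (k + k)) * (ψ x * x⁻¹ : G) := by
  have e : φ (ψ x) * x⁻¹ = (φ (ψ x * x⁻¹) * (ψ x * x⁻¹)⁻¹) * ((ψ x * x⁻¹) * (φ x * x⁻¹)) := by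
    simp only [map_mul, map_inv]; group
  have h1 : φ (ψ x * x⁻¹) * (ψ x * x⁻¹)⁻¹ ∈ (⊤ : Subgroup G).lowerCentralSeries (k + k) :=
    jk_lcs φ.toMonoidHom hφ k _ (hψ x)
  rw [e, QuotientGroup.mk_mul, (QuotientGroup.eq_one_iff _).2 h1, one_mul, jkd_comm (hψ x) (hφ x),
    QuotientGroup.mk_mul]

/-- The deep Johnson map of the inverse automorphism (`k ≥ 1`). [folklore] -/
theorem jkd_quot_symm {ψ : G ≃* G} (hψ : ∀ s, ψ s * s⁻¹ ∈ (⊤ : Subgroup G).lowerCentralSeries k) (x : G) :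
    ((ψ.symm x * x⁻¹ : G) : G ⧸ (⊤ : Subgroup G).lowerCentralSeries (k + k)) =
      ((ψ x * x⁻¹ : G) : G ⧸ (⊤ : Subgroup G).lowerCentralSeries (k + k))⁻¹ := by
  have h := jkd_quot_trans (jk_symm hψ) hψ x
  rw [MulEquiv.apply_symm_apply, mul_inv_cancel, QuotientGroup.mk_one] at h
  exact eq_inv_of_mul_eq_one_right h.symm

/-- Deep Johnson values of powers in `MulAut G` of an element of `𝒥ₖ`. [folklore] -/
theorem jkd_zpow {ψ : G ≃* G} (hk : 1 ≤ k) (hψ : ∀ s, ψ s * s⁻¹ ∈ (⊤ : Subgroup G).lowerCentralSeries k) (n : ℤ) :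
    ∀ x, ((((ψ : MulAut G) ^ n : MulAut G) x * x⁻¹ : G) : G ⧸ (⊤ : Subgroup G).lowerCentralSeries (k + k)) =
      ((ψ x * x⁻¹ : G) : G ⧸ (⊤ : Subgroup G).lowerCentralSeries (k + k)) ^ n := by
  induction n using Int.induction_on with
  | zero =>
    intro x
    rw [zpow_zero, zpow_zero, MulAut.one_apply, mul_inv_cancel, QuotientGroup.mk_one]
  | succ n ih =>
    intro x
    have e : ((ψ : MulAut G) ^ ((n : ℤ) + 1) : MulAut G) x = ((ψ : MulAut G) ^ (n : ℤ) : MulAut G) (ψ x) := by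
      rw [zpow_add_one, MulAut.mul_apply]
    rw [e, jkd_quot_trans hψ (jk_zpow hk hψ n).1, ih, zpow_add_one]
  | pred n ih =>
    intro x
    have e : ((ψ : MulAut G) ^ (-(n : ℤ) - 1) : MulAut G) x = ((ψ : MulAut G) ^ (-(n : ℤ)) : MulAut G) (ψ.symm x) := by
      rw [zpow_sub_one, MulAut.mul_apply, MulAut.inv_def]
    rw [e, jkd_quot_trans (jk_symm hψ) (jk_zpow hk hψ (-(n : ℤ))).1, ih, jkd_quot_symm hψ, zpow_sub_one]

/-- Deep Johnson values of a list product in `MulAut G` of elements of `𝒥ₖ`. [folklore] -/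
theorem jkd_list_prod {ι : Type*} (hk : 1 ≤ k) (l : List ι) (Φ : ι → MulAut G)
    (hΦ : ∀ i, ∀ s, Φ i s * s⁻¹ ∈ (⊤ : Subgroup G).lowerCentralSeries k) :
    ∀ x, (((l.map Φ).prod x * x⁻¹ : G) : G ⧸ (⊤ : Subgroup G).lowerCentralSeries (k + k)) =
      (l.map fun i => ((Φ i x * x⁻¹ : G) : G ⧸ (⊤ : Subgroup G).lowerCentralSeries (k + k))).prod := by
  induction l with
  | nil =>
    intro x
    rw [List.map_nil, List.map_nil, List.prod_nil, List.prod_nil, MulAut.one_apply, mul_inv_cancel,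
      QuotientGroup.mk_one]
  | cons i l ih =>
    intro x
    simp only [List.map_cons, List.prod_cons]
    rw [MulAut.mul_apply, jkd_quot_trans (jk_list_prod hk l Φ hΦ).1 (hΦ i), ih]

/-- **Deep Johnson values of a relation product**: for `Ψᵢ ∈ 𝒥ₖ` (`k ≥ 1`) the product `y = ∏ Ψᵢ ^ nᵢ` lies in
`𝒥ₖ` and `y(x)x⁻¹ ≡ ∏ (Ψᵢ(x)x⁻¹) ^ nᵢ (mod γ₂ₖ₊₁)` for every `x`. [folklore] -/
theorem jkd_list_prod_zpow {ι : Type*} (hk : 1 ≤ k) (l : List ι) (Ψ : ι → G ≃* G) (n : ι → ℤ)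
    (hΨ : ∀ i, ∀ s, Ψ i s * s⁻¹ ∈ (⊤ : Subgroup G).lowerCentralSeries k) :
    (∀ s, (l.map fun i => ((Ψ i : MulAut G) ^ n i : MulAut G)).prod s * s⁻¹ ∈
      (⊤ : Subgroup G).lowerCentralSeries k) ∧
    ∀ x, (((l.map fun i => ((Ψ i : MulAut G) ^ n i : MulAut G)).prod x * x⁻¹ : G) :
        G ⧸ (⊤ : Subgroup G).lowerCentralSeries (k + k)) =
      (l.map fun i => ((Ψ i x * x⁻¹ : G) : G ⧸ (⊤ : Subgroup G).lowerCentralSeries (k + k)) ^ n i).prod := by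
  refine ⟨(jk_list_prod_zpow hk l Ψ n hΨ).1, fun x => ?_⟩
  rw [jkd_list_prod hk l (fun i => ((Ψ i : MulAut G) ^ n i : MulAut G)) (fun i => (jk_zpow hk (hΨ i) (n i)).1) x]
  exact congrArg List.prod (List.map_congr_left fun i _ => jkd_zpow hk (hΨ i) (n i) x)

end General

end LayerZeroThree

/-- **Registered helper `helper_johnsonDeepProduct`** (sub-goal of stub `stub_layerStepZeroThree`, item
stmt-SmoothPoincare4-14595): deep Johnson values of relation products in the surface groups, in closed form — for
`Ψᵢ ∈ 𝒥ₖ(S_g)` (`k ≥ 1`) the product `y = ∏ Ψᵢ ^ nᵢ` (in `Aut S_g`) lies in `𝒥ₖ` and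
`y(x)x⁻¹ ≡ ∏ (Ψᵢ(x)x⁻¹) ^ nᵢ (mod γ₂ₖ₊₁)`. [folklore] -/
theorem helper_johnsonDeepProduct : ∀ (g k : ℕ), 1 ≤ k → ∀ {ι : Type*} (l : List ι) (Ψ : ι → Literature.Topology.FourManifolds.SurfaceGroup g ≃* Literature.Topology.FourManifolds.SurfaceGroup g) (n : ι → ℤ), (∀ i, ∀ s, Ψ i s * s⁻¹ ∈ (⊤ : Subgroup (Literature.Topology.FourManifolds.SurfaceGroup g)).lowerCentralSeries k) → (∀ s, (l.map fun i => ((Ψ i : MulAut (Literature.Topology.FourManifolds.SurfaceGroup g)) ^ n i : MulAut (Literature.Topology.FourManifolds.SurfaceGroup g))).prod s * s⁻¹ ∈ (⊤ : Subgroup (Literature.Topology.FourManifolds.SurfaceGroup g)).lowerCentralSeries k) ∧ ∀ x, (((l.map fun i => ((Ψ i : MulAut (Literature.Topology.FourManifolds.SurfaceGroup g)) ^ n i : MulAut (Literature.Topology.FourManifolds.SurfaceGroup g))).prod x * x⁻¹ : Literature.Topology.FourManifolds.SurfaceGroup g) : Literature.Topology.FourManifolds.SurfaceGroup g ⧸ (⊤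 : Subgroup (Literature.Topology.FourManifolds.SurfaceGroup g)).lowerCentralSeries (k + k)) = (l.map fun i => ((Ψ i x * x⁻¹ : Literature.Topology.FourManifolds.SurfaceGroup g) : Literature.Topology.FourManifolds.SurfaceGroup g ⧸ (⊤ : Subgroup (Literature.Topology.FourManifolds.SurfaceGroup g)).lowerCentralSeries (k + k)) ^ n i).prod :=
  fun _ _ hk _ l Ψ n hΨ => LayerZeroThree.jkd_list_prod_zpow hk l Ψ n hΨ

end Summit.SmoothPoincare4.SmoothPoincare4.Theorems.ShadowApproximation.NilpotentGenusClass

end
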